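import Summits.AtomisticToContinuum.BoseEinsteinCondensation.Theses.BECInsertionCorrector
import Summits.AtomisticToContinuum.BoseEinsteinCondensation.Theorems.BECInsertionCorrectorCorrectorClosureReductionToFactors
import HarnessLib

/-!
# Line `condensate-split` — crux `CorrectorClosure` (stmt-AtomisticToContinuum-12058)

Crux-strategist line (planner-cstrat-stmt-AtomisticToContinuum-12058-p1-0, 2026-08-17): the DECOMPOSITION
of `CorrectorClosure : StaticResponseBound → InsertionResidue` along the exact factorisation
`A = F · f₀` of the insertion residue (card `Lines/condensate-split.md`, census `STRATEGY-CENSUS.md`):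

* `stub_periodicBEC` — torus BEC of near-minimisers, VERBATIM the shared item stmt-AtomisticToContinuum-8997
  (field sector; necessary for the crux modulo K1 by `periodicBEC_of_correctorClosure`, p121285). NOT to be
  worked inside this line: it is the shared summit-class conjunct (`blocked-on: stmt-AtomisticToContinuum-8997`).
* `stub_removalFidelityFK_of_BEC` — bounded admissible `v`: GIVEN K1 and torus BEC, the removal FIDELITY of the
  positive Feynman–Kac ground states, `c₂ ∫ G² ≤ (∫ Θ₀ G)²` with `G = ∫_cell Φ₀(x,·)dx` (pair-density sector:
  no k = 0 removal orthogonality catastrophe). The route-specific heart.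
* `stub_hardCore_of_BEC` — unbounded admissible `v` (hard cores): GIVEN K1 and torus BEC, the body of
  `InsertionResidue` (needs the FK / positivity frame on the hard-sphere configuration space first).
* `CorrectorClosure_of` — kernel-checked composition through the landed frame
  `correctorClosure_of_periodicBEC` (p122159: `stub_groundStateExists` p92339, `stub_occupationFloorFK_of_window`,
  `stub_nearMinimiserRigidity`, `residueFloor_of_factors'`).

Exactness: with `InsertionResidueOfBEC := K1 → ∀ v adm, BEC-body v → InsertionResidue-body v` one has
`StaticResponseBound → (CorrectorClosure ↔ PeriodicBEC ∧ InsertionResidueOfBEC)`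
(`…Theorems.CorrectorClosure.Split.correctorClosure_iff_of_staticResponseBound`, p169803); stubs 2 ∧ 3 ⇒
`InsertionResidueOfBEC` through the same frame, and stub 3 is literally its unbounded-`v` half.
-/

noncomputable section

open MeasureTheory Filter Matrix
open scoped ENNReal NNReal BigOperators ComplexConjugate

namespace Summit.AtomisticToContinuum.BoseEinsteinCondensation.Cruxes.CorrectorClosure.CondensateSplit

open Literature.MathematicalPhysics.QuantumManyBody.BoseGas
open Summit.AtomisticToContinuum.BoseEinsteinCondensation.Theses.BECInsertionCorrector
open Summit.AtomisticToContinuum.BoseEinsteinCondensation.Theorems.CorrectorClosure.ResidueAreaLaw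

/-- **stub 1 (shared, summit-class; = item stmt-AtomisticToContinuum-8997 verbatim).** Torus BEC of the
`δ(N)`-near-minimisers of the periodic `N`-body problem at side `sideLength ρ N`, every admissible `v`,
`ρ < ρ₀(v)`, eventually in `N`. Do not work it here: claim / follow item 8997. -/
theorem stub_periodicBEC :
    ∀ v : ℝ → ENNReal, Literature.MathematicalPhysics.QuantumManyBody.BoseGas.IsRepulsiveFiniteRange v → ∃ ρ₀ : ℝ, 0 < ρ₀ ∧ ∀ ρ : ℝ, 0 < ρ → ρ < ρ₀ → ∃ c : ℝ, 0 < c ∧ ∀ᶠ N : ℕ in Filter.atTop, ∃ δ : ENNReal, 0 < δ ∧ ∀ Ψ : Literature.MathematicalPhysics.QuantumManyBody.BoseGas.PeriodicTrialState N (Literature.MathematicalPhysics.QuantumManyBody.BoseGas.sideLength ρ N), Literature.MathematicalPhysics.QuantumManyBody.BoseGas.periodicEnergy v Ψ ≤ Literature.MathematicalPhysics.QuantumManyBody.BoseGas.periodicGroundStateEnergy v N (Literature.MathematicalPhysics.QuantumManyBody.BoseGas.sideLength ρ N) + δ → ENNReal.ofReal (c * N) ≤ Literature.MathematicalPhysics.QuantumManyBody.BoseGas.condensateOccupation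 N (Literature.MathematicalPhysics.QuantumManyBody.BoseGas.sideLength ρ N) Ψ.ψ := by
  sorry

/-- **stub 2 (route-specific heart, bounded `v`).** Given K1 and torus BEC: removal fidelity of the positive
torus Feynman–Kac ground states `Θ₀` (`N` bodies) and `Φ₀` (`N+1` bodies) in the common box
`L = sideLength ρ (N+1)`: `c₂ ∫ G² ≤ (∫ Θ₀ G)²`, `G(X) = ∫_cell Φ₀(x, X) dx`, with `c₂ > 0` uniform in `N`.
Equivalently `F = (∫Θ₀G)²/∫G² ≥ c₂`: the normalised zero-mode removal `Ĝ` of `Φ₀` is not asymptotically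
orthogonal to `Θ₀`. What must be excluded: a soft translation-invariant pair-density tilt
`G/Θ₀ ≈ e^{t|ρ_k|²}`, `|k| = 2π/L`, which costs O(1) energy and kills the overlap (so energy + BEC alone do
not suffice; the `(N+1)`-body equation for `G`, `H_N G + ∫_cell WΦ₀ = E₀(N+1) G`, must be used). -/
theorem stub_removalFidelityFK_of_BEC :
    StaticResponseBound → ∀ v : ℝ → ℝ≥0∞, IsRepulsiveFiniteRange v →
      (∃ C : ℝ≥0, ∀ r, v r ≤ C) →
      (∃ ρ₀ : ℝ, 0 < ρ₀ ∧ ∀ ρ : ℝ, 0 < ρ → ρ < ρ₀ → ∃ c : ℝ, 0 < c ∧ ∀ᶠ N : ℕ in Filter.atTop, ∃ δ : ENNReal, 0 < δ ∧ ∀ Ψ : Literature.MathematicalPhysics.QuantumManyBody.BoseGas.PeriodicTrialState N (Literature.MathematicalPhysics.QuantumManyBody.BoseGas.sideLength ρ N), Literature.MathematicalPhysics.QuantumManyBody.BoseGas.periodicEnergy v Ψ ≤ Literature.MathematicalPhysics.QuantumManyBody.BoseGas.periodicGroundStateEnergy v N (Literature.MathematicalPhysics.QuantumManyBody.BoseGas.sideLength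 ρ N) + δ → ENNReal.ofReal (c * N) ≤ Literature.MathematicalPhysics.QuantumManyBody.BoseGas.condensateOccupation N (Literature.MathematicalPhysics.QuantumManyBody.BoseGas.sideLength ρ N) Ψ.ψ) →
      ∃ ρ₃ : ℝ, 0 < ρ₃ ∧ ∀ ρ : ℝ, 0 < ρ → ρ < ρ₃ → ∃ c₂ : ℝ, 0 < c₂ ∧
        ∀ᶠ N : ℕ in atTop, ∀ (L : ℝ), L = sideLength ρ (N + 1) →
          (∃ C : ℝ≥0, ∀ x, periodizedPotential v L x ≤ C) →
          ∀ (Θ₀ : Config N → ℝ), IsPeriodicGroundStateFK v L Θ₀ → Continuous Θ₀ → (∀ X, 0 < Θ₀ X) →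
          ∀ (Φ₀ : Config (N + 1) → ℝ), IsPeriodicGroundStateFK v L Φ₀ → Continuous Φ₀ →
            (∀ X, 0 < Φ₀ X) →
          ∀ (G : Config N → ℝ), (G = fun X => ∫ x in cell L, Φ₀ (vecCons x X)) →
            ENNReal.ofReal c₂ * ∫⁻ X in cellN N L, ENNReal.ofReal (G X) ^ 2 ≤
              ENNReal.ofReal ((∫ X in cellN N L, Θ₀ X * G X) ^ 2) := by
  sorry

/-- **stub 3 (hard cores).** Given K1 and torus BEC: the body of `InsertionResidue` for UNBOUNDED admissible
`v` (hard core + finite-range tail). Needs first the Feynman–Kac / Perron–Frobenius frame on the hard-sphere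
configuration space (ground state exists, is continuous and positive off the excluded set), then the
analogue of stub 2 and of the landed window transfers. -/
theorem stub_hardCore_of_BEC :
    StaticResponseBound → ∀ v : ℝ → ℝ≥0∞, IsRepulsiveFiniteRange v →
      (¬ ∃ C : ℝ≥0, ∀ r, v r ≤ C) →
      (∃ ρ₀ : ℝ, 0 < ρ₀ ∧ ∀ ρ : ℝ, 0 < ρ → ρ < ρ₀ → ∃ c : ℝ, 0 < c ∧ ∀ᶠ N : ℕ in Filter.atTop, ∃ δ : ENNReal, 0 < δ ∧ ∀ Ψ : Literature.MathematicalPhysics.QuantumManyBody.BoseGas.PeriodicTrialState N (Literature.MathematicalPhysics.QuantumManyBody.BoseGas.sideLength ρ N), Literature.MathematicalPhysics.QuantumManyBody.BoseGas.periodicEnergy v Ψ ≤ Literature.MathematicalPhysics.QuantumManyBody.BoseGas.periodicGroundStateEnergy v N (Literature.MathematicalPhysics.QuantumManyBody.BoseGas.sideLength ρ N) + δ → ENNReal.ofReal (c * N) ≤ Literature.MathematicalPhysics.QuantumManyBody.BoseGas.condensateOccupation N (Literature.MathematicalPhysics.QuantumManyBody.BoseGas.sideLength ρ N) Ψ.ψ)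 →
      ∃ ρ₀ : ℝ, 0 < ρ₀ ∧ ∀ ρ : ℝ, 0 < ρ → ρ < ρ₀ → ∃ c : ℝ, 0 < c ∧ ∀ᶠ N : ℕ in Filter.atTop, ∃ δ : ENNReal, 0 < δ ∧ ∃ Θ : Literature.MathematicalPhysics.QuantumManyBody.BoseGas.PeriodicTrialState N (Literature.MathematicalPhysics.QuantumManyBody.BoseGas.sideLength ρ (N + 1)), Literature.MathematicalPhysics.QuantumManyBody.BoseGas.periodicEnergy v Θ ≤ Literature.MathematicalPhysics.QuantumManyBody.BoseGas.periodicGroundStateEnergy v N (Literature.MathematicalPhysics.QuantumManyBody.BoseGas.sideLength ρ (N + 1)) + δ ∧ ∀ Ψ : Literature.MathematicalPhysics.QuantumManyBody.BoseGas.PeriodicTrialState (N + 1) (Literature.MathematicalPhysics.QuantumManyBody.BoseGas.sideLength ρ (N + 1)), Literature.MathematicalPhysics.QuantumManyBody.BoseGas.periodicEnergy v Ψ ≤ Literature.MathematicalPhysics.QuantumManyBody.BoseGas.periodicGroundStateEnergy v (N + 1) (Literature.MathematicalPhysics.QuantumManyBody.BoseGas.sideLength ρ (N + 1)) + δ → ENNReal.ofReal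 c ≤ ENNReal.ofReal ((Literature.MathematicalPhysics.QuantumManyBody.BoseGas.sideLength ρ (N + 1) ^ 3)⁻¹) * (‖∫ X in Literature.MathematicalPhysics.QuantumManyBody.BoseGas.cellN N (Literature.MathematicalPhysics.QuantumManyBody.BoseGas.sideLength ρ (N + 1)), conj (Θ.ψ X) * ∫ x in Literature.MathematicalPhysics.QuantumManyBody.BoseGas.cell (Literature.MathematicalPhysics.QuantumManyBody.BoseGas.sideLength ρ (N + 1)), Ψ.ψ (Matrix.vecCons x X)‖₊ : ENNReal) ^ 2 := by
  sorry

/-- **Composition (kernel-checked): the three stubs give the crux BY NAME.** Through the landed frame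
`correctorClosure_of_periodicBEC` (p122159), feeding torus BEC (stub 1) to stubs 2 and 3. -/
theorem CorrectorClosure_of :
    Summit.AtomisticToContinuum.BoseEinsteinCondensation.Theses.BECInsertionCorrector.CorrectorClosure :=
  correctorClosure_of_periodicBEC stub_periodicBEC
    (fun hK1 v hv hb => stub_removalFidelityFK_of_BEC hK1 v hv hb (stub_periodicBEC v hv))
    (fun hK1 v hv hub => stub_hardCore_of_BEC hK1 v hv hub (stub_periodicBEC v hv))

/-- The same composition with the stubs as explicit hypotheses (for citation / modus ponens). -/
theorem correctorClosure_of_stubs :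
        (∀ v : ℝ → ENNReal, Literature.MathematicalPhysics.QuantumManyBody.BoseGas.IsRepulsiveFiniteRange v → ∃ ρ₀ : ℝ, 0 < ρ₀ ∧ ∀ ρ : ℝ, 0 < ρ → ρ < ρ₀ → ∃ c : ℝ, 0 < c ∧ ∀ᶠ N : ℕ in Filter.atTop, ∃ δ : ENNReal, 0 < δ ∧ ∀ Ψ : Literature.MathematicalPhysics.QuantumManyBody.BoseGas.PeriodicTrialState N (Literature.MathematicalPhysics.QuantumManyBody.BoseGas.sideLength ρ N), Literature.MathematicalPhysics.QuantumManyBody.BoseGas.periodicEnergy v Ψ ≤ Literature.MathematicalPhysics.QuantumManyBody.BoseGas.periodicGroundStateEnergy v N (Literature.MathematicalPhysics.QuantumManyBody.BoseGas.sideLength ρ N) + δ → ENNReal.ofReal (c * N) ≤ Literature.MathematicalPhysics.QuantumManyBody.BoseGas.condensateOccupation N (Literature.MathematicalPhysics.QuantumManyBody.BoseGas.sideLength ρ N) Ψ.ψ) →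
    (StaticResponseBound → ∀ v : ℝ → ℝ≥0∞, IsRepulsiveFiniteRange v →
      (∃ C : ℝ≥0, ∀ r, v r ≤ C) →
      (∃ ρ₀ : ℝ, 0 < ρ₀ ∧ ∀ ρ : ℝ, 0 < ρ → ρ < ρ₀ → ∃ c : ℝ, 0 < c ∧ ∀ᶠ N : ℕ in Filter.atTop, ∃ δ : ENNReal, 0 < δ ∧ ∀ Ψ : Literature.MathematicalPhysics.QuantumManyBody.BoseGas.PeriodicTrialState N (Literature.MathematicalPhysics.QuantumManyBody.BoseGas.sideLength ρ N), Literature.MathematicalPhysics.QuantumManyBody.BoseGas.periodicEnergy v Ψ ≤ Literature.MathematicalPhysics.QuantumManyBody.BoseGas.periodicGroundStateEnergy v N (Literature.MathematicalPhysics.QuantumManyBody.BoseGas.sideLength ρ N) + δ → ENNReal.ofReal (c * N) ≤ Literature.MathematicalPhysics.QuantumManyBody.BoseGas.condensateOccupation N (Literature.MathematicalPhysics.QuantumManyBody.BoseGas.sideLength ρ N) Ψ.ψ) →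
      ∃ ρ₃ : ℝ, 0 < ρ₃ ∧ ∀ ρ : ℝ, 0 < ρ → ρ < ρ₃ → ∃ c₂ : ℝ, 0 < c₂ ∧
        ∀ᶠ N : ℕ in atTop, ∀ (L : ℝ), L = sideLength ρ (N + 1) →
          (∃ C : ℝ≥0, ∀ x, periodizedPotential v L x ≤ C) →
          ∀ (Θ₀ : Config N → ℝ), IsPeriodicGroundStateFK v L Θ₀ → Continuous Θ₀ → (∀ X, 0 < Θ₀ X) →
          ∀ (Φ₀ : Config (N + 1) → ℝ), IsPeriodicGroundStateFK v L Φ₀ → Continuous Φ₀ →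
            (∀ X, 0 < Φ₀ X) →
          ∀ (G : Config N → ℝ), (G = fun X => ∫ x in cell L, Φ₀ (vecCons x X)) →
            ENNReal.ofReal c₂ * ∫⁻ X in cellN N L, ENNReal.ofReal (G X) ^ 2 ≤
              ENNReal.ofReal ((∫ X in cellN N L, Θ₀ X * G X) ^ 2)) →
    (StaticResponseBound → ∀ v : ℝ → ℝ≥0∞, IsRepulsiveFiniteRange v →
      (¬ ∃ C : ℝ≥0, ∀ r, v r ≤ C) →
      (∃ ρ₀ : ℝ, 0 < ρ₀ ∧ ∀ ρ : ℝ, 0 < ρ → ρ < ρ₀ → ∃ c : ℝ, 0 < c ∧ ∀ᶠ N : ℕ in Filter.atTop, ∃ δ : ENNReal, 0 < δ ∧ ∀ Ψ : Literature.MathematicalPhysics.QuantumManyBody.BoseGas.PeriodicTrialState N (Literature.MathematicalPhysics.QuantumManyBody.BoseGas.sideLength ρ N), Literature.MathematicalPhysics.QuantumManyBody.BoseGas.periodicEnergy v Ψ ≤ Literature.MathematicalPhysics.QuantumManyBody.BoseGas.periodicGroundStateEnergy v N (Literature.MathematicalPhysics.QuantumManyBody.BoseGas.sideLength ρ N) +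 δ → ENNReal.ofReal (c * N) ≤ Literature.MathematicalPhysics.QuantumManyBody.BoseGas.condensateOccupation N (Literature.MathematicalPhysics.QuantumManyBody.BoseGas.sideLength ρ N) Ψ.ψ) →
      ∃ ρ₀ : ℝ, 0 < ρ₀ ∧ ∀ ρ : ℝ, 0 < ρ → ρ < ρ₀ → ∃ c : ℝ, 0 < c ∧ ∀ᶠ N : ℕ in Filter.atTop, ∃ δ : ENNReal, 0 < δ ∧ ∃ Θ : Literature.MathematicalPhysics.QuantumManyBody.BoseGas.PeriodicTrialState N (Literature.MathematicalPhysics.QuantumManyBody.BoseGas.sideLength ρ (N + 1)), Literature.MathematicalPhysics.QuantumManyBody.BoseGas.periodicEnergy v Θ ≤ Literature.MathematicalPhysics.QuantumManyBody.BoseGas.periodicGroundStateEnergy v N (Literature.MathematicalPhysics.QuantumManyBody.BoseGas.sideLength ρ (N + 1)) + δ ∧ ∀ Ψ : Literature.MathematicalPhysics.QuantumManyBody.BoseGas.PeriodicTrialState (N + 1) (Literature.MathematicalPhysics.QuantumManyBody.BoseGas.sideLength ρ (N + 1)), Literature.MathematicalPhysics.QuantumManyBody.BoseGas.periodicEnergy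 v Ψ ≤ Literature.MathematicalPhysics.QuantumManyBody.BoseGas.periodicGroundStateEnergy v (N + 1) (Literature.MathematicalPhysics.QuantumManyBody.BoseGas.sideLength ρ (N + 1)) + δ → ENNReal.ofReal c ≤ ENNReal.ofReal ((Literature.MathematicalPhysics.QuantumManyBody.BoseGas.sideLength ρ (N + 1) ^ 3)⁻¹) * (‖∫ X in Literature.MathematicalPhysics.QuantumManyBody.BoseGas.cellN N (Literature.MathematicalPhysics.QuantumManyBody.BoseGas.sideLength ρ (N + 1)), conj (Θ.ψ X) * ∫ x in Literature.MathematicalPhysics.QuantumManyBody.BoseGas.cell (Literature.MathematicalPhysics.QuantumManyBody.BoseGas.sideLength ρ (N + 1)), Ψ.ψ (Matrix.vecCons x X)‖₊ : ENNReal) ^ 2) →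
    Summit.AtomisticToContinuum.BoseEinsteinCondensation.Theses.BECInsertionCorrector.CorrectorClosure :=
  fun h₁ h₂ h₃ =>
    correctorClosure_of_periodicBEC h₁ (fun hK1 v hv hb => h₂ hK1 v hv hb (h₁ v hv))
      (fun hK1 v hv hub => h₃ hK1 v hv hub (h₁ v hv))

end Summit.AtomisticToContinuum.BoseEinsteinCondensation.Cruxes.CorrectorClosure.CondensateSplit

end
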